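import Summits.PneNP.PneNP.Theorems.SingleThreshold.Negative.PlantedCliqueFree
import Literature.Computability.Complexity.RossmanMonotoneCliqueApprox
import Literature.Computability.Complexity.RossmanMonotoneCliqueGraphs
import Literature.Computability.Complexity.NegationElimination

/-!
# Lemma 13 under the planted law (Rossman 2010, Lemmas 11 and 13, shifted by a planted pattern)

Route `OneSlice`, crux `Summit.PneNP.PneNP.Theses.OneSlice.SingleThreshold` (stmt-PneNP-2833), line
`two-round-exposure`: the registered stub `stub_plantedApproxError` (stub L, the calibration of the
reduction of the crux to the structural ⋆-closed approximators).

Setting: a well-formed straight-line program `gs` over `{∧₂, ∨₂}` on the edges of `K_n`, and wire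
approximators `ap` in the structural ⋆-closed form of Rossman (FOCS 2010, §5.2): input wires are
exact (`ap (inl i) = (· i)`), an `∧`-gate is the exact conjunction of the approximators of its
children, an `∨`-gate is the ⋆-closure `starClosure p t K` (`K = smallI n k ∪ medJ n k`) of the
disjunction of the approximators of its children; all valid wires are monotone.

**What.** `stub_plantedApproxError`: on the PLANTED input `z = x ⊔ K_A` (`x ∼ G(n,p)` with weights
`gnpWeight n p`, `A` a uniformly random `k`-set, law `kSubsetProb n k`) some gate of `gs` disagrees
with its approximator with probability at most `|gs| · |K| · t` — the bound of Rossman's Lemma 13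
(`StarApproxInv.err`, stated there for the plain input `x`), now under planting.

**How** (Rossman 2010, proofs of Lemmas 11 and 13 with `x ⊔ h` in place of `x`, for a FIXED
pattern `h`, then averaged over `h = K_A`).
* `prob_clIter_flip_sup_le` — one shifted closure round: a flip of round `r` at `x ⊔ h` (iterate
  `g_r` rejects `x ⊔ h`, `g_{r+1}` accepts it) needs a newly accepted pattern `h' ≤ x ⊔ h`
  (`h' ∈ clNew r`, as `g_r h' = 0` by monotonicity), and then `g_r (x ⊔ h') = 0` since
  `x ⊔ h' ≤ x ⊔ h` — an event of probability `fails p g_r h' ≤ t`; union bound over `clNew r`.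
* `prob_flip_le_sum_seq` (telescoping over the rounds) and `sum_card_clNew_le` (at most `|K|`
  patterns are ever added) give the **planted Lemma 11** `prob_lt_starClosure_sup_le`:
  `Pr_x[f (x ⊔ h) = 0 ∧ f⋆ (x ⊔ h) = 1] ≤ |K| · t` for monotone `f`.
* `prob_disagree_sup_le` — the **planted Lemma 13** for a fixed `h`, by induction along the program
  (`List.reverseRecOn`, as in `StarApproxInv.snoc`): off the bad event of the prefix every valid
  wire agrees with its approximator at `x ⊔ h` (`wire_eq_ap_of_not_bad`), so an appended `∧`-gate
  never disagrees (clause `hand`) and an appended `∨̄`-gate disagrees only on the planted Lemma 11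
  event of `ap u ∨ ap v` (clause `hor`, `le_starClosure`); union bound.
* `stub_plantedApproxError` — swap the two averages (`sum_gnpWeight_mul_kSubsetProb`), identify
  `gnpProb` with `prob` (`gnpProb_filter_eq_prob`), apply the fixed-`h` bound at `h = cliqueVec A`
  and average over the `C(n,k)` sets `A`.

## References

* B. Rossman, *The monotone complexity of k-clique on random graphs*, FOCS 2010 (full version
  2009), §5.1 with Lemmas 10–11 (p. 7), §5.2 with Lemma 13 (p. 8) [Rossman2010].
-/

noncomputable section

set_option linter.dupNamespace false

open Finset

open scoped Classical

namespace Summit.PneNP.PneNP.Theorems.SingleThreshold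

open Literature.Computability.Complexity GateList
open Summit.PneNP.PneNP.Theorems.SingleThreshold.Negative (Edges)

/-! ### Lemma 11 under planting: the closure rarely exceeds `f` on `x ⊔ h` -/

section Planted

variable {ι : Type*} [Fintype ι] [DecidableEq ι]

omit [Fintype ι] [DecidableEq ι] in
/-- Two comparable distinct Booleans are `false < true`. [folklore] -/
theorem eq_false_and_eq_true_of_le_of_ne {a b : Bool} (hle : a ≤ b) (hne : a ≠ b) :
    a = false ∧ b = true := by
  rw [Bool.le_iff_imp] at hle
  cases a <;> cases b <;> simp_all

/-- **One shifted closure round**: `Pr_x[g_r (x ⊔ h) = 0, g_{r+1} (x ⊔ h) = 1] ≤ |New_r| · t` — a flip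
at `x ⊔ h` needs a newly accepted `h' ≤ x ⊔ h`, and then `g_r (x ⊔ h') = 0` as `x ⊔ h' ≤ x ⊔ h`, an
event of probability `fails p g_r h' ≤ t` (Rossman 2010, proof of Lemma 11, with `x ⊔ h` for `x`).
[cite: Rossman2010, Lemma 11 (p. 7)] -/
theorem prob_clIter_flip_sup_le {p t : ℝ} (hp0 : 0 ≤ p) (hp1 : p ≤ 1) (K : Finset (ι → Bool))
    {f : (ι → Bool) → Bool} (hf : Monotone f) (h : ι → Bool) (r : ℕ) :
    prob p (fun x => clIter p t K f r (x ⊔ h) = false ∧ clIter p t K f (r + 1) (x ⊔ h) = true)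
      ≤ #(clNew p t K f r) * t := by
  set g := clIter p t K f r with hg
  have hgm : Monotone g := monotone_clIter p t K hf r
  calc prob p (fun x => g (x ⊔ h) = false ∧ clIter p t K f (r + 1) (x ⊔ h) = true)
      ≤ prob p (fun x => ∃ h' ∈ clNew p t K f r, g (x ⊔ h) = false ∧ onSet h' ⊆ onSet (x ⊔ h)) := by
        refine prob_mono hp0 hp1 fun x ⟨hx0, hx1⟩ => ?_
        rw [clIter_succ] at hx1
        simp only [clStep, ← hg, hx0, Bool.false_or, decide_eq_true_eq] at hx1
        obtain ⟨h', hh', hle⟩ := hx1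
        refine ⟨h', ?_, hx0, hle⟩
        rw [clAdd, mem_filter] at hh'
        rw [clNew, mem_filter]
        exact ⟨hh'.1, hh'.2, eq_false_of_monotone_le hgm ((le_iff_onSet_subset h' _).2 hle) hx0⟩
    _ ≤ ∑ h' ∈ clNew p t K f r, prob p (fun x => g (x ⊔ h) = false ∧ onSet h' ⊆ onSet (x ⊔ h)) :=
        prob_exists_le hp0 hp1 _ _
    _ ≤ ∑ h' ∈ clNew p t K f r, t := by
        refine sum_le_sum fun h' hh' => ?_
        rw [clNew, mem_filter] at hh'
        refine le_trans (prob_mono hp0 hp1 fun x ⟨hx0, hle⟩ => ?_) hh'.2.1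
        have hle' : x ⊔ h' ≤ x ⊔ h := sup_le le_sup_left ((le_iff_onSet_subset h' _).2 hle)
        change g (x ⊔ h') = false
        exact eq_false_of_monotone_le hgm hle' hx0
    _ = #(clNew p t K f r) * t := by rw [sum_const, nsmul_eq_mul]

/-- **Telescoping** along a sequence of Boolean functions: a flip from `F 0 = 0` to `F N = 1`
happens in some round `r < N`. [folklore] -/
theorem prob_flip_le_sum_seq {p : ℝ} (hp0 : 0 ≤ p) (hp1 : p ≤ 1) (F : ℕ → (ι → Bool) → Bool)
    (N : ℕ) :
    prob p (fun x => F 0 x = false ∧ F N x = true)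
      ≤ ∑ r ∈ range N, prob p (fun x => F r x = false ∧ F (r + 1) x = true) := by
  induction N with
  | zero =>
    rw [sum_range_zero]
    refine le_of_eq ((prob_congr fun x => ?_).trans (prob_false p))
    simp only [iff_false, not_and]
    intro h1 h2
    rw [h1] at h2
    exact Bool.noConfusion h2
  | succ N ih =>
    rw [sum_range_succ]
    calc prob p (fun x => F 0 x = false ∧ F (N + 1) x = true)
        ≤ prob p (fun x => (F 0 x = false ∧ F N x = true) ∨
            (F N x = false ∧ F (N + 1) x = true)) := by
          refine prob_mono hp0 hp1 fun x ⟨h0, h1⟩ => ?_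
          rcases hN : F N x with _ | _
          · exact Or.inr ⟨rfl, h1⟩
          · exact Or.inl ⟨h0, rfl⟩
      _ ≤ _ := (prob_or_le hp0 hp1 _ _).trans (by linarith)

/-- **Lemma 11 under planting** (Rossman 2010, Lemma 11, with a fixed planted pattern `h`):
`Pr_x[f (x ⊔ h) = 0 ∧ f⋆ (x ⊔ h) = 1] ≤ |K| · t` for monotone `f` and `t ≥ 0` — planting can only make
sure patterns surer. [cite: Rossman2010, Lemma 11 (p. 7)] -/
theorem prob_lt_starClosure_sup_le {p t : ℝ} (hp0 : 0 ≤ p) (hp1 : p ≤ 1) (ht : 0 ≤ t)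
    (K : Finset (ι → Bool)) {f : (ι → Bool) → Bool} (hf : Monotone f) (h : ι → Bool) :
    prob p (fun x => f (x ⊔ h) = false ∧ starClosure p t K f (x ⊔ h) = true) ≤ #K * t := by
  refine (prob_flip_le_sum_seq hp0 hp1 (fun r x => clIter p t K f r (x ⊔ h)) (#K + 1)).trans ?_
  refine (sum_le_sum fun r _ => prob_clIter_flip_sup_le hp0 hp1 K hf h r).trans ?_
  rw [← sum_mul]
  refine mul_le_mul_of_nonneg_right ?_ ht
  exact_mod_cast sum_card_clNew_le p t K f _

/-! ### Lemma 13 under planting, for a fixed planted pattern -/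

omit [Fintype ι] [DecidableEq ι] in
/-- Off the bad event of the program at an input `z`, every valid wire agrees with its
approximator at `z` (input wires by exactness). [folklore] -/
theorem wire_eq_ap_of_not_bad {gs : List (Gate ι)} {ap : ι ⊕ ℕ → (ι → Bool) → Bool}
    (hinl : ∀ i, ap (Sum.inl i) = fun x => x i) {z : ι → Bool}
    (hz : ¬ ∃ m < gs.length, (vals gs z).getD m false ≠ ap (Sum.inr m) z) :
    ∀ w, OutOK gs.length w → wireOf z (vals gs z) w = ap w z := by
  rintro (i | m) hw
  · rw [hinl i]; rfl
  · have hm := hw m rfl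
    by_contra hne
    exact hz ⟨m, hm, hne⟩

/-- **Lemma 13 under planting, fixed pattern** (Rossman 2010, Lemma 13 with `x ⊔ h` for `x`): for
the structural ⋆-closed approximators `ap` of a well-formed `{∧₂, ∨₂}`-program `gs` (inputs exact,
`∧` exact, `∨ ↦ (ap u ∨ ap v)⋆` w.r.t. `K`, valid wires monotone) and any fixed pattern `h`,
`Pr_x[∃ gate m, value of m at x ⊔ h ≠ ap (inr m) (x ⊔ h)] ≤ |gs| · |K| · t`. Induction along the
program: an appended `∧`-gate never disagrees off the bad event of the prefix, an appended `∨̄`-gate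
only on the planted Lemma 11 event (`prob_lt_starClosure_sup_le`); union bound.
[cite: Rossman2010, Lemma 13 (p. 8)] -/
theorem prob_disagree_sup_le {p t : ℝ} (hp0 : 0 ≤ p) (hp1 : p ≤ 1) (ht : 0 ≤ t)
    (K : Finset (ι → Bool)) (h : ι → Bool) :
    ∀ (gs : List (Gate ι)) (ap : ι ⊕ ℕ → (ι → Bool) → Bool),
      WF gs → (∀ g ∈ gs, g.fn ∈ monotoneBasis) →
      (∀ i, ap (Sum.inl i) = fun x => x i) →
      (∀ (m : ℕ) (u v : ι ⊕ ℕ), gs[m]? = some (andGate u v) →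
        ap (Sum.inr m) = fun x => ap u x && ap v x) →
      (∀ (m : ℕ) (u v : ι ⊕ ℕ), gs[m]? = some (orGate u v) →
        ap (Sum.inr m) = starClosure p t K (fun x => ap u x || ap v x)) →
      (∀ w, OutOK gs.length w → Monotone (ap w)) →
      prob p (fun x => ∃ m < gs.length, (vals gs (x ⊔ h)).getD m false ≠ ap (Sum.inr m) (x ⊔ h))
        ≤ gs.length * (#K * t) := by
  intro gs
  induction gs using List.reverseRecOn with
  | nil =>
    intro ap _ _ _ _ _ _
    refine le_of_eq (((prob_congr fun x => ?_).trans (prob_false p)).trans (by simp))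
    simp
  | append_singleton gs g ih =>
    intro ap hwf hB hinl hand hor hmono
    have hlen : (gs ++ [g]).length = gs.length + 1 := by simp
    have hKt : (0 : ℝ) ≤ #K * t := mul_nonneg (Nat.cast_nonneg _) ht
    -- the hypotheses restrict to the prefix `gs`
    have hpre : ∀ {m : ℕ} {g' : Gate ι}, gs[m]? = some g' → (gs ++ [g])[m]? = some g' :=
      fun hm => by rw [List.getElem?_append_left (List.getElem?_eq_some_iff.1 hm).1]; exact hm
    have hOK : ∀ w : ι ⊕ ℕ, OutOK gs.length w → OutOK (gs ++ [g]).length w := fun w hw m hm => by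
      rw [hlen]; exact Nat.lt_succ_of_lt (hw m hm)
    have ih' := ih ap hwf.of_append_left (fun g' hg' => hB g' (List.mem_append_left _ hg')) hinl
      (fun m u v hm => hand m u v (hpre hm)) (fun m u v hm => hor m u v (hpre hm))
      (fun w hw => hmono w (hOK w hw))
    -- the appended gate
    have hgOK : GateOK gs.length g := hwf.gateOK_mid (post := [])
    have hgB : g.fn ∈ monotoneBasis := hB g (by simp)
    have hnew : ∀ z, (vals (gs ++ [g]) z).getD gs.length false =
        g.op (fun a => wireOf z (vals gs z) (g.args a)) := fun z => getD_vals_append_cons gs g [] z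
    have hlast : (gs ++ [g])[gs.length]? = some g := by simp
    simp only [monotoneBasis, Set.mem_insert_iff, Set.mem_singleton_iff] at hgB
    rcases hgB with hc | hc
    · -- an `∧`-gate never disagrees off the bad event of the prefix
      obtain ⟨u, v, rfl⟩ := exists_eq_andGate_of_fn_eq hc
      have hu : OutOK gs.length u := fun m hm => hgOK (0 : Fin 2) m hm
      have hv : OutOK gs.length v := fun m hm => hgOK (1 : Fin 2) m hm
      have hsub : ∀ x, (∃ m < (gs ++ [andGate u v]).length,
            (vals (gs ++ [andGate u v]) (x ⊔ h)).getD m false ≠ ap (Sum.inr m) (x ⊔ h)) →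
          ∃ m < gs.length, (vals gs (x ⊔ h)).getD m false ≠ ap (Sum.inr m) (x ⊔ h) := by
        rintro x ⟨m, hm, hne⟩
        by_contra hbad
        rw [hlen] at hm
        by_cases hmeq : m = gs.length
        · subst hmeq
          exact hne (by rw [hnew, andGate_op, wire_eq_ap_of_not_bad hinl hbad u hu,
            wire_eq_ap_of_not_bad hinl hbad v hv, hand gs.length u v hlast])
        · have hm' : m < gs.length := by omega
          exact hbad ⟨m, hm', by rwa [getD_vals_append_singleton_of_lt gs _ _ hm'] at hne⟩
      refine (prob_mono hp0 hp1 hsub).trans (ih'.trans ?_)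
      rw [hlen]; push_cast; linarith
    · -- an `∨̄`-gate disagrees only on the planted Lemma 11 event of `ap u ∨ ap v`
      obtain ⟨u, v, rfl⟩ := exists_eq_orGate_of_fn_eq hc
      have hu : OutOK gs.length u := fun m hm => hgOK (0 : Fin 2) m hm
      have hv : OutOK gs.length v := fun m hm => hgOK (1 : Fin 2) m hm
      have hfm : Monotone fun y => ap u y || ap v y :=
        monotone_bor (hmono u (hOK u hu)) (hmono v (hOK v hv))
      have hsub : ∀ x, (∃ m < (gs ++ [orGate u v]).length,
            (vals (gs ++ [orGate u v]) (x ⊔ h)).getD m false ≠ ap (Sum.inr m) (x ⊔ h)) →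
          (∃ m < gs.length, (vals gs (x ⊔ h)).getD m false ≠ ap (Sum.inr m) (x ⊔ h)) ∨
            ((fun y => ap u y || ap v y) (x ⊔ h) = false ∧
              starClosure p t K (fun y => ap u y || ap v y) (x ⊔ h) = true) := by
        rintro x ⟨m, hm, hne⟩
        by_cases hbad : ∃ m < gs.length, (vals gs (x ⊔ h)).getD m false ≠ ap (Sum.inr m) (x ⊔ h)
        · exact Or.inl hbad
        · right
          rw [hlen] at hm
          by_cases hmeq : m = gs.length
          · subst hmeq
            rw [hnew, orGate_op, wire_eq_ap_of_not_bad hinl hbad u hu,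
              wire_eq_ap_of_not_bad hinl hbad v hv, hor gs.length u v hlast] at hne
            exact eq_false_and_eq_true_of_le_of_ne
              (le_starClosure p t K (fun y => ap u y || ap v y) (x ⊔ h)) hne
          · have hm' : m < gs.length := by omega
            exact absurd ⟨m, hm', by rwa [getD_vals_append_singleton_of_lt gs _ _ hm'] at hne⟩ hbad
      refine (prob_mono hp0 hp1 hsub).trans ((prob_or_le hp0 hp1 _ _).trans ?_)
      refine (add_le_add ih' (prob_lt_starClosure_sup_le hp0 hp1 ht K hfm h)).trans ?_
      rw [hlen]; push_cast; exact le_of_eq (by ring)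

end Planted

/-! ### The registered stub: averaging over the planted clique -/

/-- **Stub L — Lemma 13 under the planted law** (Rossman 2010, Lemma 13, on the planted input;
stub `stub_plantedApproxError` of line `two-round-exposure`). For the structural ⋆-closed
approximation `ap` of a well-formed `{∧₂, ∨₂}`-program `gs` on the edges of `K_n` (input wires exact,
`∧`-gates exact conjunctions, `∨`-gates the ⋆-closure of the disjunction w.r.t.
`K = smallI n k ∪ medJ n k` at bias `0 ≤ p ≤ 1` and trigger `t ≥ 0`; all valid wires monotone), the
gates disagree with their approximators on the PLANTED input `x ⊔ K_A` (`x ∼ G(n,p)`, `A` a uniformly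
random `k`-set) with probability at most `|gs| · |K| · t` — the bound of Lemma 13 (`StarApproxInv.err`)
for the plain input. Proof: swap the two averages (`sum_gnpWeight_mul_kSubsetProb`), and for each
fixed `A` apply the fixed-pattern bound `prob_disagree_sup_le` at `h = cliqueVec A` (induction along
the program; the only error source is an `∨̄`-gate, controlled by the planted Lemma 11
`prob_lt_starClosure_sup_le`). [cite: Rossman2010, Lemma 13 (p. 8)] -/
theorem stub_plantedApproxError {n k : ℕ} {p t : ℝ} (hp0 : 0 ≤ p) (hp1 : p ≤ 1) (ht : 0 ≤ t)
    (gs : List (Gate (Edges n))) (ap : Edges n ⊕ ℕ → (Edges n → Bool) → Bool)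
    (hwf : GateList.WF gs) (hB : ∀ g ∈ gs, g.fn ∈ monotoneBasis)
    (hinl : ∀ i, ap (Sum.inl i) = fun x => x i)
    (hand : ∀ (m : ℕ) (u v : Edges n ⊕ ℕ), gs[m]? = some (GateList.andGate u v) →
        ap (Sum.inr m) = fun x => ap u x && ap v x)
    (hor : ∀ (m : ℕ) (u v : Edges n ⊕ ℕ), gs[m]? = some (GateList.orGate u v) →
        ap (Sum.inr m) = starClosure p t (smallI n k ∪ medJ n k) (fun x => ap u x || ap v x))
    (hmono : ∀ w, GateList.OutOK gs.length w → Monotone (ap w)) :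
    (∑ x : Edges n → Bool, gnpWeight n p x * kSubsetProb n k (fun A =>
        ∃ m < gs.length, (vals gs (x ⊔ cliqueVec A)).getD m false ≠ ap (Sum.inr m) (x ⊔ cliqueVec A)))
      ≤ gs.length * (#(smallI n k ∪ medJ n k) * t) := by
  set K := smallI n k ∪ medJ n k
  have hKt : (0 : ℝ) ≤ gs.length * (#K * t) :=
    mul_nonneg (Nat.cast_nonneg _) (mul_nonneg (Nat.cast_nonneg _) ht)
  rw [Negative.sum_gnpWeight_mul_kSubsetProb]
  -- the fixed-pattern bound for each planted clique `K_A`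
  have hA : ∀ A ∈ powersetCard k (univ : Finset (Fin n)),
      gnpProb n p (univ.filter fun x : Edges n → Bool => ∃ m < gs.length,
        (vals gs (x ⊔ cliqueVec A)).getD m false ≠ ap (Sum.inr m) (x ⊔ cliqueVec A))
        ≤ gs.length * (#K * t) := by
    intro A _
    rw [gnpProb_filter_eq_prob]
    exact prob_disagree_sup_le hp0 hp1 ht K (cliqueVec A) gs ap hwf hB hinl hand hor hmono
  have hS := sum_le_sum hA
  rw [sum_const, card_powersetCard, card_univ, Fintype.card_fin, nsmul_eq_mul] at hS
  rcases Nat.eq_zero_or_pos (n.choose k) with h0 | hpos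
  · rw [h0, Nat.cast_zero, div_zero]
    exact hKt
  · have hpos' : (0 : ℝ) < n.choose k := by exact_mod_cast hpos
    rw [div_le_iff₀ hpos']
    calc _ ≤ (n.choose k : ℝ) * (gs.length * (#K * t)) := hS
      _ = gs.length * (#K * t) * (n.choose k) := by ring

end Summit.PneNP.PneNP.Theorems.SingleThreshold

end
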